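import Summits.SmoothPoincare4.SmoothPoincare4.Theorems.EntropyRungThreeShrinkerGap
import Literature.Geometry.Riemannian.ThreeShrinkerClassificationOfF2
import Literature.Geometry.Riemannian.ThreeShrinkerNullRicci
import HarnessLib

/-!
# Line `collapsed-ends-usc` of crux `EntropyRung.NoncompactShrinkerGap`: the 3-d rung after (F1)

Lead c12 of the crux line (item stmt-SmoothPoincare4-10868). The registered stub
`stub_threeShrinkerGap : EntropyRung.ThreeShrinkerGap` (= item stmt-SmoothPoincare4-16586) rests on
the Literature fact `threeShrinkerClassification_modelData`, which the literature seat reduced to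
two curvature inputs on complete noncompact three-dimensional shrinkers with `R > 0`
(`ThreeShrinker.modelData_of_curvature_inputs`): (F1) `Ric ≥ 0` (Chen 2009, Cor. 2.4) and (F2) a
null vector of `Ric` (Munteanu–Wang 2017, Thm. 2, contrapositive). This session PROVED (F1) in the
tree (`Literature.Geometry.Riemannian.ThreeShrinker.ricci_nonneg`, even `sect ≥ 0`:
`ThreeShrinker.two_mul_ricci_le_scalarCurvature`, file `ThreeShrinkerSectionalNonneg.lean`, by an
elliptic Hamilton–Ivey maximum principle). Registered helpers of the crux item:

* `helper_threeShrinker_ricci_nonneg` — (F1) verbatim as the hypothesis `hF1` of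
  `ThreeShrinker.modelData_of_curvature_inputs`;
* `helper_threeShrinkerGap_of_F2` — **the route item `ThreeShrinkerGap` from (F2) ALONE**
  (`threeShrinkerClassification_modelData_of_F2` + `threeShrinkerGap_of_classification`), so the
  skeleton's `stub_threeShrinkerGap` is replaced by the strictly smaller stub (F2);
* `helper_threeShrinkerGap_of_infiniteVolume` (appended, v16) — `ThreeShrinkerGap` from the named
  fact `ricciNonneg_infiniteVolume` (Calabi–Yau) ALONE, the three steps of (F2) being theorems.

## References

* B.-L. Chen, J. Differential Geom. 82 (2009), Cor. 2.4. [Chen2009]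
* O. Munteanu, J. Wang, arXiv:1606.01861, Thm. 1.2; J. Differential Geom. 106 (2017), Thm. 2.
  [MunteanuWang2016] [MunteanuWang2017]
-/

noncomputable section

-- `Summit.SmoothPoincare4.SmoothPoincare4.…` (summit = problem) trips `dupNamespace` on every decl.
set_option linter.dupNamespace false

open scoped Manifold ContDiff Topology NNReal ENNReal
open MeasureTheory Set
open Literature.Geometry.Lorentzian Literature.Geometry.Riemannian

namespace Summit.SmoothPoincare4.SmoothPoincare4.Theorems.NoncompactShrinkerGapThreeShrinkerRicci

/-- **Helper `helper_threeShrinker_ricci_nonneg` (input (F1), Chen 2009 Cor. 2.4, PROVED)**: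
every complete connected normalised three-dimensional gradient shrinker — here under the two
extra hypotheses `NoncompactSpace N`, `R > 0` carried by `hF1` of
`ThreeShrinker.modelData_of_curvature_inputs`, which are not used — has `Ric ≥ 0`.
[cite: Chen2009, Cor. 2.4] -/
theorem helper_threeShrinker_ricci_nonneg : ∀ (N : Type) [TopologicalSpace N] [T2Space N] [SecondCountableTopology N] [ChartedSpace (EuclideanSpace ℝ (Fin 3)) N] [IsManifold (𝓡 3) ∞ N] [ConnectedSpace N] [T3Space N] [MeasurableSpace N] [BorelSpace N] (h : PseudoRiemannianMetric (𝓡 3) ∞ (EuclideanSpace ℝ (Fin 3)) (TangentSpace (𝓡 3) : N → Type _)) [h.HasLeviCivita] (φ : N → ℝ) (hh : h.IsRiemannian), (∀ (x : N) (r : NNReal), IsCompact {y : N | h.edist hh x y ≤ r}) → ContMDiff (𝓡 3) 𝓘(ℝ, ℝ) ∞ φ → (∀ (x : N) (X Y : TangentSpace (𝓡 3) x), h.ricci x X Y + h.hessian φ x X Y = (1 / 2 : ℝ) * h.val x X Y) → (∀ x : N, h.scalarCurvature x + h.gradSq φ x = φ x) → NoncompactSpace N → (∀ x : N, 0 < h.scalarCurvature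 x) → ∀ (x : N) (w : TangentSpace (𝓡 3) x), 0 ≤ h.ricci x w w :=
  fun _ _ _ _ _ _ _ _ _ _ h _ φ hh hcpl hφ hsol hnorm _ _ x w ↦
    ThreeShrinker.ricci_nonneg h φ hh hcpl hφ hsol hnorm x w

/-- **Helper `helper_threeShrinkerGap_of_F2` — the route item `ThreeShrinkerGap` from (F2)
alone**: if every complete connected normalised noncompact three-dimensional gradient shrinker
with `R > 0` has a null vector of `Ric` (Munteanu–Wang 2017, Thm. 2, contrapositive), then
`EntropyRung.ThreeShrinkerGap` holds (classification from (F2) by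
`threeShrinkerClassification_modelData_of_F2`, (F1) being `ThreeShrinker.ricci_nonneg`; then
`ThreeShrinkerGap.threeShrinkerGap_of_classification`).
[cite: MunteanuWang2017, Thm. 2] [cite: MunteanuWang2016, Thm. 1.2 (p. 3)] -/
theorem helper_threeShrinkerGap_of_F2 : (∀ (N : Type) [TopologicalSpace N] [T2Space N] [SecondCountableTopology N] [ChartedSpace (EuclideanSpace ℝ (Fin 3)) N] [IsManifold (𝓡 3) ∞ N] [ConnectedSpace N] [T3Space N] [MeasurableSpace N] [BorelSpace N] (h : PseudoRiemannianMetric (𝓡 3) ∞ (EuclideanSpace ℝ (Fin 3)) (TangentSpace (𝓡 3) : N → Type _)) [h.HasLeviCivita] (φ : N → ℝ) (hh : h.IsRiemannian), (∀ (x : N) (r : NNReal), IsCompact {y : N | h.edist hh x y ≤ r}) → ContMDiff (𝓡 3) 𝓘(ℝ, ℝ) ∞ φ → (∀ (x : N) (X Y : TangentSpace (𝓡 3) x), h.ricci x X Y + h.hessian φ x X Y = (1 / 2 : ℝ) * h.val x X Y) → (∀ x : N, h.scalarCurvature x + h.gradSq φ x = φ x) → NoncompactSpace N → (∀ x : N,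 0 < h.scalarCurvature x) → ∃ (p : N) (w : TangentSpace (𝓡 3) p), w ≠ 0 ∧ h.ricci p w w = 0) → Summit.SmoothPoincare4.SmoothPoincare4.Theses.EntropyRung.ThreeShrinkerGap :=
  fun hF2 ↦ ThreeShrinkerGap.threeShrinkerGap_of_classification
    (threeShrinkerClassification_modelData_of_F2 hF2)

/-- **Helper `helper_threeShrinkerGap_of_infiniteVolume` — the route item `ThreeShrinkerGap`
from Calabi–Yau's infinite-volume theorem alone** (v16 of the line): (F1) and the three steps of
(F2) being theorems of the tree (`ThreeShrinkerSectionalNonneg`, `ThreeShrinkerRicciLowerBound`,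
`ThreeShrinkerScalarCurvatureLog`, `ThreeShrinkerVolumeBound`), the classification of
three-dimensional shrinkers — hence `EntropyRung.ThreeShrinkerGap` — follows from the named fact
`Literature.Geometry.Riemannian.ricciNonneg_infiniteVolume` (complete noncompact `Ric ≥ 0` ⇒
infinite volume, Yau 1976). [cite: MunteanuWang2016, Thm. 1.2 (p. 3)] [cite: MunteanuWang2017, Thm. 2] -/
theorem helper_threeShrinkerGap_of_infiniteVolume :
    Literature.Geometry.Riemannian.ricciNonneg_infiniteVolume →
      Summit.SmoothPoincare4.SmoothPoincare4.Theses.EntropyRung.ThreeShrinkerGap :=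
  fun hY ↦ ThreeShrinkerGap.threeShrinkerGap_of_classification
    (threeShrinkerClassification_modelData_of_infiniteVolume hY)

end Summit.SmoothPoincare4.SmoothPoincare4.Theorems.NoncompactShrinkerGapThreeShrinkerRicci

end
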